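import Literature.Geometry.Lorentzian.KerrGKSTrappingCollar
import HarnessLib

/-!
# GKS Proposition 3.8.12: the quartic `3r⁴ − 6a²r² − a⁴` is non-negative outside the horizon exactly
# for `|a| ≤ (3/4)^(1/4) M ≈ 0.9306 M` (kernel certificate of a printed threshold)

(family `gr`; namespace `Literature.Geometry.Lorentzian.Kerr`; companion of
`KerrGKSTrappingRegion.lean`, `KerrGKSHardyPositivity.lean`, `KerrGKSTrappingCollar.lean` — the
`|a| ≪ M` census of Giorgi–Klainerman–Szeftel, arXiv:2205.14808 = Pure Appl. Math. Q. (2024);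
`Kerr.rPlus M a = M + √(M² − a²)` is the event-horizon radius from `KerrSchild.lean`.)

GKS §3.8.2 (null geodesics; TeX l.6990–7022, PAMQ p. 152–153), with the choice `h = (r² + a²)³/r`:
"`ℛ̃″ = −8a²r/(r² + a²)² λ_z² − 2m(3r⁴ − 6a²r² − a⁴)/(r²(r² + a²)²) κ²`. Observe that `ℛ̃″ ≤ 0`
as long as `3r⁴ − 6a²r² − a⁴ ≥ 0`. Note that `3r⁴ − 6a²r² − a⁴ ≥ 0` if `r² ≥ a²(3 + 2√3)/3`, for
`r ≥ r₊`. It thus suffices to check the sign on the horizon … This implies … which is verified for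
`|a|/m = |λ| ≤ (3/(3 + √3))√((3 + 2√3)/3) ≃ 0.9306`. In particular, for Kerr spacetime with
`|a/m| ≤ 0.93`, we have `−ℛ̃″ ≥ 0` for `r ≥ r₊`" — this is the hypothesis "`|a/m| ≤ 0.93`" of
**Proposition 3.8.12** (the only place in GKS where a smallness-type restriction on `a/m` is an
explicit number; it is not used later in the paper). This file proves, for the quartic
`P(r) = 3r⁴ − 6a²r² − a⁴` (`Kerr.gksGeodesicQuartic`):
* `gksGeodesicQuartic_rPlus`: `P(r₊) = 4r₊²(2(M² − a²) + 2M√(M² − a²) − M²)`;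
* `gksGeodesicQuartic_mono`: `P(r₊) ≤ P(r)` for `r ≥ r₊` (`|a| ≤ M`), so the sign at the horizon
  decides;
* `gksGeodesicQuartic_nonneg` — **the printed claim**: `|a| ≤ 0.93 M`, `r ≥ r₊` ⟹ `P(r) ≥ 0`;
* `gksGeodesicQuartic_rPlus_neg`: `0.931 M ≤ |a| ≤ M` ⟹ `P(r₊) < 0` (the threshold is sharp to
  3 digits);
* `gksGeodesicQuartic_rPlus_nonneg_iff` — **the exact threshold**: `P(r₊) ≥ 0 ⟺ a⁴ ≤ (3/4)M⁴`, i.e.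
  `|a|/M ≤ (3/4)^(1/4) = 0.930604…`; indeed the printed constant simplifies,
  `((3/(3+√3))²·(3+2√3)/3 = √3/2 = ((3/4)^(1/4))²`, a remark the source does not make).
Elementary real algebra; recorded for the census of quantified `a/m`-restrictions in GKS.

## References
* E. Giorgi, S. Klainerman, J. Szeftel, arXiv:2205.14808, §3.8.2, Prop. 3.8.12 (TeX l.6990–7025);
  Pure Appl. Math. Q. (2024), doi:10.4310/pamq.241128023033, pp. 152–153
  (key `GiorgiKlainermanSzeftel2022`).
-/

noncomputable section

namespace Literature.Geometry.Lorentzian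

namespace Kerr

open Real

/-- The quartic `P(r) = 3r⁴ − 6a²r² − a⁴` of GKS §3.8.2 (sign of `ℛ̃″` for null geodesics with the
choice `h = (r² + a²)³/r`). [cite: GiorgiKlainermanSzeftel2022, Prop. 3.8.12 (§3.8.2)] -/
def gksGeodesicQuartic (a r : ℝ) : ℝ :=
  3 * r ^ 4 - 6 * a ^ 2 * r ^ 2 - a ^ 4

/-- Unfolding lemma. [cite: GiorgiKlainermanSzeftel2022, Prop. 3.8.12 (§3.8.2)] -/
theorem gksGeodesicQuartic_def (a r : ℝ) :
    gksGeodesicQuartic a r = 3 * r ^ 4 - 6 * a ^ 2 * r ^ 2 - a ^ 4 := rfl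

/-- **Value at the horizon**: `P(r₊) = 4r₊²(2(M² − a²) + 2M√(M² − a²) − M²)` for `|a| ≤ M`.
[cite: GiorgiKlainermanSzeftel2022, Prop. 3.8.12 (§3.8.2)] -/
theorem gksGeodesicQuartic_rPlus {M a : ℝ} (ha : |a| ≤ M) :
    gksGeodesicQuartic a (rPlus M a) =
      4 * rPlus M a ^ 2 * (2 * (M ^ 2 - a ^ 2) + 2 * M * √(M ^ 2 - a ^ 2) - M ^ 2) := by
  have ha2 : a ^ 2 ≤ M ^ 2 := by
    rw [← sq_abs]; exact pow_le_pow_left₀ (abs_nonneg a) ha 2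
  have hd : √(M ^ 2 - a ^ 2) ^ 2 = M ^ 2 - a ^ 2 := Real.sq_sqrt (by linarith)
  simp only [gksGeodesicQuartic, rPlus]
  linear_combination (-a ^ 2 - (M ^ 2 - √(M ^ 2 - a ^ 2) ^ 2)
    + 2 * (M + √(M ^ 2 - a ^ 2)) ^ 2) * hd

/-- **Monotonicity outside the horizon**: `P(r) − P(r₊) = 3(r² − r₊²)(r² + r₊² − 2a²) ≥ 0` for
`r ≥ r₊` (`|a| ≤ M`, so `r₊ ≥ M ≥ |a|`); "It thus suffices to check the sign on the horizon".
[cite: GiorgiKlainermanSzeftel2022, Prop. 3.8.12 (§3.8.2)] -/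
theorem gksGeodesicQuartic_mono {M a r : ℝ} (ha : |a| ≤ M) (hr : rPlus M a ≤ r) :
    gksGeodesicQuartic a (rPlus M a) ≤ gksGeodesicQuartic a r := by
  have hM : 0 ≤ M := (abs_nonneg a).trans ha
  have hRM : M ≤ rPlus M a := by
    unfold rPlus; linarith [Real.sqrt_nonneg (M ^ 2 - a ^ 2)]
  have hRa : |a| ≤ rPlus M a := ha.trans hRM
  have haR : a ^ 2 ≤ rPlus M a ^ 2 := by
    rw [← sq_abs]; exact pow_le_pow_left₀ (abs_nonneg a) hRa 2
  have h1 : 0 ≤ r - rPlus M a := by linarith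
  have h2 : 0 ≤ r + rPlus M a := by linarith [hM.trans hRM]
  have h3 : 0 ≤ r ^ 2 + rPlus M a ^ 2 - 2 * a ^ 2 := by nlinarith
  simp only [gksGeodesicQuartic]
  nlinarith [mul_nonneg (mul_nonneg h1 h2) h3]

/-- **GKS Prop. 3.8.12's hypothesis, as printed**: for `|a| ≤ 0.93 M` (`0 < M`) and `r ≥ r₊`,
`3r⁴ − 6a²r² − a⁴ ≥ 0` (hence `−ℛ̃″ ≥ 0` there).
[cite: GiorgiKlainermanSzeftel2022, Prop. 3.8.12 (§3.8.2)] -/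
theorem gksGeodesicQuartic_nonneg {M a r : ℝ} (hM : 0 < M) (ha : |a| ≤ 93 / 100 * M)
    (hr : rPlus M a ≤ r) : 0 ≤ gksGeodesicQuartic a r := by
  have haM : |a| ≤ M := ha.trans (by linarith)
  have ha2 : a ^ 2 ≤ (93 / 100 * M) ^ 2 := by
    rw [← sq_abs]; exact pow_le_pow_left₀ (abs_nonneg a) ha 2
  refine le_trans ?_ (gksGeodesicQuartic_mono haM hr)
  rw [gksGeodesicQuartic_rPlus haM]
  have hMa : 0 ≤ M ^ 2 - a ^ 2 := by nlinarith
  set d := √(M ^ 2 - a ^ 2) with hd_def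
  have hd0 : 0 ≤ d := Real.sqrt_nonneg _
  have hd2 : d ^ 2 = M ^ 2 - a ^ 2 := Real.sq_sqrt hMa
  -- `d² ≥ (1 − 0.93²)M² = 0.1351 M²`, so `d ≥ 0.3675 M`, so `2d² + 2Md − M² ≥ 0.0052 M² > 0`
  have hd1 : 3675 / 10000 * M ≤ d := by nlinarith
  have hE : 0 ≤ 2 * (M ^ 2 - a ^ 2) + 2 * M * d - M ^ 2 := by nlinarith
  positivity

/-- **Sharpness to three digits**: for `0.931 M ≤ |a| ≤ M` (`0 < M`), `P(r₊) < 0` — the sign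
condition of §3.8.2 fails at the horizon.
[cite: GiorgiKlainermanSzeftel2022, Prop. 3.8.12 (§3.8.2)] -/
theorem gksGeodesicQuartic_rPlus_neg {M a : ℝ} (hM : 0 < M) (ha : 931 / 1000 * M ≤ |a|)
    (haM : |a| ≤ M) : gksGeodesicQuartic a (rPlus M a) < 0 := by
  have ha2 : (931 / 1000 * M) ^ 2 ≤ a ^ 2 := by
    have h := pow_le_pow_left₀ (by positivity) ha 2
    rwa [sq_abs] at h
  have ha2' : a ^ 2 ≤ M ^ 2 := by
    rw [← sq_abs]; exact pow_le_pow_left₀ (abs_nonneg a) haM 2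
  rw [gksGeodesicQuartic_rPlus haM]
  have hr0 : 0 < rPlus M a := by unfold rPlus; positivity
  have hMa : 0 ≤ M ^ 2 - a ^ 2 := by linarith
  set d := √(M ^ 2 - a ^ 2) with hd_def
  have hd0 : 0 ≤ d := Real.sqrt_nonneg _
  have hd2 : d ^ 2 = M ^ 2 - a ^ 2 := Real.sq_sqrt hMa
  -- `d² ≤ (1 − 0.931²)M² = 0.133239 M² < (0.3651 M)²`, so `d < 0.3651 M`, so `2d² + 2Md − M² < 0`
  have hd1 : d ≤ 3651 / 10000 * M := by nlinarith
  have hE : 2 * (M ^ 2 - a ^ 2) + 2 * M * d - M ^ 2 < 0 := by nlinarith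
  have h4 : 0 < 4 * rPlus M a ^ 2 := by positivity
  exact mul_neg_of_pos_of_neg h4 hE

/-- **The exact threshold of Prop. 3.8.12**: for `0 < M`, `|a| ≤ M`:
`P(r₊) ≥ 0 ⟺ a⁴ ≤ (3/4)M⁴`, i.e. `|a| ≤ (3/4)^(1/4) M = 0.930604… M` (the printed
`(3/(3+√3))√((3+2√3)/3) ≃ 0.9306` squared is `√3/2`). Combined with `gksGeodesicQuartic_mono`:
`P ≥ 0` on `[r₊, ∞)` iff `a⁴ ≤ (3/4)M⁴`.
[cite: GiorgiKlainermanSzeftel2022, Prop. 3.8.12 (§3.8.2)] -/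
theorem gksGeodesicQuartic_rPlus_nonneg_iff {M a : ℝ} (hM : 0 < M) (haM : |a| ≤ M) :
    0 ≤ gksGeodesicQuartic a (rPlus M a) ↔ a ^ 4 ≤ 3 / 4 * M ^ 4 := by
  have ha2' : a ^ 2 ≤ M ^ 2 := by
    rw [← sq_abs]; exact pow_le_pow_left₀ (abs_nonneg a) haM 2
  rw [gksGeodesicQuartic_rPlus haM]
  have hr0 : 0 < rPlus M a := by unfold rPlus; positivity
  have h4 : 0 < 4 * rPlus M a ^ 2 := by positivity
  rw [mul_nonneg_iff_of_pos_left h4]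
  have hMa : 0 ≤ M ^ 2 - a ^ 2 := by linarith
  set d := √(M ^ 2 - a ^ 2) with hd_def
  have hd0 : 0 ≤ d := Real.sqrt_nonneg _
  have hd2 : d ^ 2 = M ^ 2 - a ^ 2 := Real.sq_sqrt hMa
  -- `E := 2(M² − a²) + 2Md − M² = M² − 2a² + 2Md`; `E ≥ 0 ⟺ 2Md ≥ 2a² − M²`, and comparing squares
  -- (`(2Md)² = 4M⁴ − 4M²a²`, `(2a² − M²)² = 4a⁴ − 4a²M² + M⁴`) gives `⟺ 3M⁴ ≥ 4a⁴`.
  constructor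
  · intro hE
    by_cases hc : 2 * a ^ 2 - M ^ 2 ≤ 0
    · nlinarith [sq_nonneg (a ^ 2), pow_pos hM 4]
    · push Not at hc
      have h1 : 2 * a ^ 2 - M ^ 2 ≤ 2 * M * d := by linarith
      have h2 : (2 * a ^ 2 - M ^ 2) ^ 2 ≤ (2 * M * d) ^ 2 :=
        pow_le_pow_left₀ hc.le h1 2
      nlinarith [h2]
  · intro h
    by_cases hc : 2 * a ^ 2 - M ^ 2 ≤ 0
    · nlinarith [mul_nonneg hM.le hd0]
    · push Not at hc
      have h2 : (2 * a ^ 2 - M ^ 2) ^ 2 ≤ (2 * M * d) ^ 2 := by nlinarith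
      have h1 : 2 * a ^ 2 - M ^ 2 ≤ 2 * M * d :=
        (pow_le_pow_iff_left₀ hc.le (by positivity) two_ne_zero).mp h2
      nlinarith [h1]

/-- Corollary (the exact form of the printed statement): for `0 < M`, `a⁴ ≤ (3/4)M⁴` (in particular
for `|a| ≤ 0.93 M`) the quartic is non-negative on the whole exterior `r ≥ r₊`.
[cite: GiorgiKlainermanSzeftel2022, Prop. 3.8.12 (§3.8.2)] -/
theorem gksGeodesicQuartic_nonneg_of_pow_four_le {M a r : ℝ} (hM : 0 < M)
    (ha : a ^ 4 ≤ 3 / 4 * M ^ 4) (hr : rPlus M a ≤ r) : 0 ≤ gksGeodesicQuartic a r := by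
  have haM : |a| ≤ M := by
    have h1 : a ^ 4 ≤ M ^ 4 := ha.trans (by nlinarith [pow_pos hM 4])
    have h2 : |a| ^ 4 ≤ M ^ 4 := by rwa [pow_abs, abs_of_nonneg (by positivity : (0:ℝ) ≤ a ^ 4)]
    exact (pow_le_pow_iff_left₀ (abs_nonneg a) hM.le (by norm_num)).mp h2
  exact ((gksGeodesicQuartic_rPlus_nonneg_iff hM haM).2 ha).trans (gksGeodesicQuartic_mono haM hr)

end Kerr

end Literature.Geometry.Lorentzian

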